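import Summits.BirchSwinnertonDyer.BirchSwinnertonDyer.Theorems.GenusKolyvaginAtTwoTorsionCellRedeiAdjugate
import Literature.NumberTheory.QuadraticFields.RedeiReichardtFourRank
import HarnessLib

/-!
# LINE 49 «full_vertex» — Cor 10.3 of the pen's memo #4: `det B(Q₀,p₀)` is the constant cofactor of `Ĝ(insert p₀ Q₀)`, and `= [r₄(ℚ(√−p₀M₀)) = 0]`

Crux R″ `RankOneTwoTorsionResidualAtTwo` (stmt-BirchSwinnertonDyer-27478) of route GenusKolyvaginAtTwo, LINE 49
«torsion_cell_full_vertex_bsdidea1» (pen bsd-idea-1); sequel of `…TorsionCellRedeiAdjugate` (Thm 10.2).  This file hosts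
§6–§8 of the pen's HOME-only brick `line49/engine/RedeiAdjugate.lean` r2, DEF-FREE (the brick's reindexing gadgets
`inclInsert`/`basePt`/`equivCompl`/`enum`/`tuple` are written out: the inclusion `Q₀ ↪ insert p₀ Q₀` is the lambda
`fun q => ⟨q, _⟩`, the base point is `⟨p₀, _⟩`, and §7 is stated for an ARBITRARY enumeration `e : Fin t ≃ T`).

§6 COR 10.3 for the BORDERED LAPLACIAN of LINE 49 (`…FullVertexDefs.borderedLaplacian`): `borderedLaplacian_eq_submatrix`
   (`B(Q₀,p₀)` = the submatrix of `Ĝ(insert p₀ Q₀)` on `Q₀`, `p₀ ∉ Q₀`), `det_borderedLaplacian_eq_adjugate` (`det B` = the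
   principal cofactor at `p₀`), `det_borderedLaplacian_eq_adjugate_apply` ((a): `det B = adj(Ĝ(T))_{xy}` for ALL `x, y`;
   `#Q₀` even), `det_borderedLaplacian_eq_one_iff` ((b): `det B = 1 ⟺ #ker Ĝ(T) = 2`), `det_borderedLaplacian_eq_of_insert_eq`
   ((c): `insert p₀ Q₀ = insert p₁ Q₁ ⟹ det B(Q₀,p₀) = det B(Q₁,p₁)` — which prime is deleted does not matter).
§7 CLASS-GROUP READING: `redeiMatrix_enum_eq_submatrix` (Li–Ma's `RM(−n)` along any enumeration `e : Fin t ≃ T` IS `Ĝ(T)`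
   reindexed), `card_ker_redeiMatrix_enum_eq`, `prod_mod_four_eq`, and the doors — UNCONDITIONAL, through the tree's PROOF
   `redeiReichardt_fourTwoCard_classGroup_holds` of the Rédei–Reichardt theorem —
   **`det_borderedLaplacian_eq_one_iff_fourTwoCard_eq_one`** ((d): `det B(Q₀,p₀) = 1 ⟺ #(Cl² ∩ Cl[2])(ℚ(√−p₀M₀)) = 1`, i.e.
   `r₄ = 0`, `M₀ = ∏ Q₀`) and **`noIdealClassOfOrderFour_of_det_borderedLaplacian_eq_one`** ((e): `⟹` no ideal class of order
   `4` in `ℚ(√−p₀M₀)` — Tian's non-degeneracy condition).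

In LINE 49 the bit `det B(Q₀,p₀)` is the bottom coefficient `a_N` of the norm form of `det Φ₃(B)` (`…TorsionCellPhi3NormForm`,
`charpoly_coeff_zero_eq_det`); the Selmer-genericity criterion itself is `det Φ₃(B) = 1`, NOT `det B = 1` — this file gives
the class-group meaning of one summand only.  Everything is proved (no `sorry`, standard axioms); nothing here is a statement
of the line, and NOTHING HERE PROVES R″ or any summit — BSD is not advanced by this file alone.

## References

* [LiMa2008] [RedeiReichardt1934] Rédei–Reichardt `r₄ = t − 1 − rank RM(D)` (tree `RedeiMatrixFourRank` / `RedeiReichardtFourRank`).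
* [Tian2014] Y. Tian, *Congruent numbers and Heegner points*, Cambridge J. Math. 2 (2014), Thm. 1.1 (no ideal class of order 4).
-/

namespace Summit.BirchSwinnertonDyer.BirchSwinnertonDyer.Theorems.GenusKolyvaginAtTwo.FullVertex.RedeiAdjugate

open Matrix Finset
open Literature.Combinatorics.Digraph.Multidigraph (adjugate_self_eq_det_submatrix_compl)
open Literature.NumberTheory.QuadraticFields.RedeiReichardt

/-! ## §6 Cor 10.3: the BORDERED LAPLACIAN `B(Q₀, p₀)` is the principal minor at `p₀` of `Ĝ(insert p₀ Q₀)` -/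

section Bordered

variable (Q₀ : Finset ℕ) (p₀ : ℕ)

/-- The inclusion `Q₀ ↪ insert p₀ Q₀` of index types (`q ↦ ⟨q, _⟩`) is injective. [cite: RedeiReichardt1934] -/
theorem inclInsert_injective :
    Function.Injective (fun q : ↥Q₀ => (⟨q.1, mem_insert_of_mem q.2⟩ : ↥(insert p₀ Q₀))) := by
  intro a b h
  exact Subtype.ext (congrArg Subtype.val h : _)

/-- The base point `⟨p₀, _⟩` of `insert p₀ Q₀` is not in the image of `Q₀` (for `p₀ ∉ Q₀`). [cite: RedeiReichardt1934] -/
theorem basePt_ne_inclInsert (h₀ : p₀ ∉ Q₀) (i : ↥Q₀) :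
    (⟨p₀, mem_insert_self p₀ Q₀⟩ : ↥(insert p₀ Q₀)) ≠ ⟨i.1, mem_insert_of_mem i.2⟩ := by
  intro h
  apply h₀
  have h' : p₀ = (i : ℕ) := congrArg Subtype.val h
  rw [h']
  exact i.2

/-- **`B(Q₀, p₀)` is the submatrix of `Ĝ(insert p₀ Q₀)` on the rows and columns of `Q₀`** (for `p₀ ∉ Q₀`).
(Brick `borderedLaplacian_eq_submatrix`.) [cite: RedeiReichardt1934] [cite: HeathBrown1994SelmerCongruentII, §2] -/
theorem borderedLaplacian_eq_submatrix (h₀ : p₀ ∉ Q₀) :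
    borderedLaplacian Q₀ p₀ = (redeiLaplacian (insert p₀ Q₀)).submatrix
      (fun q : ↥Q₀ => (⟨q.1, mem_insert_of_mem q.2⟩ : ↥(insert p₀ Q₀)))
      (fun q : ↥Q₀ => (⟨q.1, mem_insert_of_mem q.2⟩ : ↥(insert p₀ Q₀))) := by
  set ι : ↥Q₀ → ↥(insert p₀ Q₀) := fun q => ⟨q.1, mem_insert_of_mem q.2⟩ with hι
  set b : ↥(insert p₀ Q₀) := ⟨p₀, mem_insert_self p₀ Q₀⟩ with hb
  have hιinj : Function.Injective ι := inclInsert_injective Q₀ p₀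
  ext j i
  rw [submatrix_apply]
  by_cases hij : i = j
  · subst hij
    unfold borderedLaplacian
    rw [Matrix.add_apply, diagonal_apply_eq, redeiLaplacian_apply_self, redeiLaplacian_apply_self]
    have hPi : b ≠ ι i := basePt_ne_inclInsert Q₀ p₀ h₀ i
    have hp₀i : b ∈ univ.erase (ι i) := mem_erase.mpr ⟨hPi, mem_univ _⟩
    -- the row sum over `insert p₀ Q₀` minus the diagonal and the `p₀` term is the image of the row sum over `Q₀`
    have himg : (univ.erase (ι i)).erase b = (univ.erase i).image ι := by
      ext x
      simp only [mem_erase, mem_image, mem_univ, and_true, ne_eq]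
      constructor
      · rintro ⟨hxP, hxi⟩
        have hxQ : (x : ℕ) ∈ Q₀ := by
          rcases mem_insert.mp x.2 with hx | hx
          · exact (hxP (Subtype.ext hx)).elim
          · exact hx
        refine ⟨⟨x, hxQ⟩, fun h => hxi ?_, Subtype.ext rfl⟩
        rw [← h]
      · rintro ⟨a, hai, rfl⟩
        exact ⟨fun h => (basePt_ne_inclInsert Q₀ p₀ h₀ a h.symm).elim, fun h => hai (hιinj h)⟩
    have hsum : ∑ x ∈ (univ.erase (ι i)).erase b, redeiLaplacian (insert p₀ Q₀) (ι i) x =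
        ∑ a ∈ univ.erase i, redeiLaplacian Q₀ i a := by
      rw [himg, Finset.sum_image (fun _ _ _ _ h => hιinj h)]
      refine Finset.sum_congr rfl fun a ha => ?_
      rw [redeiLaplacian_apply_of_ne _ (ne_of_mem_erase ha),
        redeiLaplacian_apply_of_ne _ (fun h => (ne_of_mem_erase ha) (hιinj h))]
    have hpt : redeiLaplacian (insert p₀ Q₀) (ι i) b = legendreBit (-(p₀ : ℤ)) (i : ℕ) := by
      rw [redeiLaplacian_apply_of_ne _ hPi]
    rw [← Finset.add_sum_erase _ _ hp₀i, hsum, hpt, add_comm]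
  · unfold borderedLaplacian
    rw [Matrix.add_apply, diagonal_apply_ne _ (Ne.symm hij), add_zero, redeiLaplacian_apply_of_ne _ hij,
      redeiLaplacian_apply_of_ne _ (fun h => hij (hιinj h))]

/-- **`det B(Q₀, p₀)` = the principal cofactor of `Ĝ(insert p₀ Q₀)` at `p₀`.**  (Brick `det_borderedLaplacian_eq_adjugate`;
the equivalence `Q₀ ≃ {p₀}ᶜ` is built inside the proof.) [cite: RedeiReichardt1934] -/
theorem det_borderedLaplacian_eq_adjugate (h₀ : p₀ ∉ Q₀) :
    (borderedLaplacian Q₀ p₀).det =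
      (redeiLaplacian (insert p₀ Q₀)).adjugate ⟨p₀, mem_insert_self p₀ Q₀⟩ ⟨p₀, mem_insert_self p₀ Q₀⟩ := by
  -- `Q₀ ≃ {p₀}ᶜ` inside `insert p₀ Q₀`, compatible with the inclusions
  let e : ↥Q₀ ≃ ↥(({(⟨p₀, mem_insert_self p₀ Q₀⟩ : ↥(insert p₀ Q₀))} : Finset ↥(insert p₀ Q₀))ᶜ) :=
    { toFun := fun q => ⟨⟨q.1, mem_insert_of_mem q.2⟩, by
        rw [Finset.mem_compl, Finset.mem_singleton]
        intro h
        apply h₀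
        have h' : (q : ℕ) = p₀ := congrArg Subtype.val h
        rw [← h']; exact q.2⟩
      invFun := fun x => ⟨(x.1 : ℕ), by
        rcases mem_insert.mp x.1.2 with hx | hx
        · exfalso
          have hx' := x.2
          rw [Finset.mem_compl, Finset.mem_singleton] at hx'
          exact hx' (Subtype.ext hx)
        · exact hx⟩
      left_inv := fun q => Subtype.ext rfl
      right_inv := fun x => Subtype.ext (Subtype.ext rfl) }
  rw [adjugate_self_eq_det_submatrix_compl, ← det_submatrix_equiv_self e, submatrix_submatrix,
    borderedLaplacian_eq_submatrix Q₀ p₀ h₀]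
  rfl

/-- **Cor 10.3 (a): `det B` is the constant cofactor** — for `T = insert p₀ Q₀` a set of primes `≡ 3 (mod 4)` with `#Q₀`
even, `det B(Q₀, p₀) = adj(Ĝ(T))_{xy}` for ALL `x, y`. [cite: RedeiReichardt1934] [cite: LiMa2008, Thm. 0.4] -/
theorem det_borderedLaplacian_eq_adjugate_apply (h₀ : p₀ ∉ Q₀)
    (hT : ∀ q ∈ insert p₀ Q₀, q.Prime ∧ q % 4 = 3) (hev : Even Q₀.card) (x y : ↥(insert p₀ Q₀)) :
    (borderedLaplacian Q₀ p₀).det = (redeiLaplacian (insert p₀ Q₀)).adjugate x y := by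
  have hodd : Odd (insert p₀ Q₀).card := by
    rw [card_insert_of_notMem h₀]; exact hev.add_one
  rw [det_borderedLaplacian_eq_adjugate Q₀ p₀ h₀]
  exact redeiLaplacian_adjugate_apply_eq _ hT hodd _ _ x y

/-- **Cor 10.3 (b): `det B(Q₀, p₀) = 1 ⟺ #ker Ĝ(insert p₀ Q₀) = 2`** (`⟺ rank Ĝ(T) = #T − 1`). [cite: RedeiReichardt1934]
[cite: LiMa2008, Thm. 0.4] -/
theorem det_borderedLaplacian_eq_one_iff (h₀ : p₀ ∉ Q₀)
    (hT : ∀ q ∈ insert p₀ Q₀, q.Prime ∧ q % 4 = 3) (hev : Even Q₀.card) :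
    (borderedLaplacian Q₀ p₀).det = 1 ↔
      Fintype.card {v : ↥(insert p₀ Q₀) → ZMod 2 // redeiLaplacian (insert p₀ Q₀) *ᵥ v = 0} = 2 := by
  have hodd : Odd (insert p₀ Q₀).card := by
    rw [card_insert_of_notMem h₀]; exact hev.add_one
  rw [det_borderedLaplacian_eq_adjugate Q₀ p₀ h₀, adjugate_self_eq_det_submatrix_compl]
  exact det_redeiLaplacian_submatrix_compl_eq_one_iff _ hT hodd _

/-- **Cor 10.3 (c): which prime is called `p₀` does not matter** — if `insert p₀ Q₀ = insert p₁ Q₁` (same set `T` of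
primes `≡ 3 (mod 4)`, odd size) then `det B(Q₀, p₀) = det B(Q₁, p₁)`. [cite: RedeiReichardt1934] [cite: LiMa2008, Thm. 0.4] -/
theorem det_borderedLaplacian_eq_of_insert_eq {Q₀ Q₁ : Finset ℕ} {p₀ p₁ : ℕ} (h : insert p₀ Q₀ = insert p₁ Q₁)
    (h₀ : p₀ ∉ Q₀) (h₁ : p₁ ∉ Q₁) (hT : ∀ q ∈ insert p₀ Q₀, q.Prime ∧ q % 4 = 3) (hev : Even Q₀.card) :
    (borderedLaplacian Q₀ p₀).det = (borderedLaplacian Q₁ p₁).det := by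
  have hodd : Odd (insert p₀ Q₀).card := by
    rw [card_insert_of_notMem h₀]; exact hev.add_one
  rw [det_borderedLaplacian_eq_adjugate Q₀ p₀ h₀, det_borderedLaplacian_eq_adjugate Q₁ p₁ h₁]
  -- generalize the second set to a variable and substitute
  suffices key : ∀ (T₁ : Finset ℕ), insert p₀ Q₀ = T₁ → ∀ (s₀ : ↥(insert p₀ Q₀)) (s₁ : ↥T₁),
      (redeiLaplacian (insert p₀ Q₀)).adjugate s₀ s₀ = (redeiLaplacian T₁).adjugate s₁ s₁ from
    key _ h _ _
  intro T₁ hT₁ s₀ s₁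
  subst hT₁
  exact redeiLaplacian_adjugate_apply_eq _ hT hodd _ _ _ _

end Bordered

/-! ## §7 The class-group reading of `det B`: `Ĝ(T)` along ANY enumeration `e : Fin t ≃ T` IS Li–Ma's `RM(−n)`, `n = ∏ T` -/

section ClassGroup

open Literature.NumberTheory.EllipticCurves.Smith2016 (natCast_zmod_ne_zero_of_prime_ne)
open Literature.NumberTheory.EllipticCurves.Tian2014 (IsQuadraticFieldOfSqrt fourTwoCard)
open Literature.NumberTheory.EllipticCurves.LiLiuTian2024 (NoIdealClassOfOrderFour)
open NumberField

/-- A product of numbers `≡ 3 (mod 4)` is `≡ 1` or `≡ 3 (mod 4)` according as the number of factors is even or odd.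
[cite: RedeiReichardt1934] -/
theorem prod_mod_four_eq (T : Finset ℕ) (hT : ∀ q ∈ T, q % 4 = 3) :
    (∏ q ∈ T, q) % 4 = if Even T.card then 1 else 3 := by
  classical
  induction T using Finset.induction_on with
  | empty => simp
  | insert a s ha ih =>
    have ha3 : a % 4 = 3 := hT a (mem_insert_self a s)
    have ih' := ih fun q hq => hT q (mem_insert_of_mem hq)
    rw [prod_insert ha, card_insert_of_notMem ha, Nat.mul_mod, ha3, ih']
    by_cases hs : Even s.card
    · have hns : ¬ Even (s.card + 1) := fun h => by
        rw [Nat.even_add_one] at h; exact h hs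
      rw [if_pos hs, if_neg hns]
    · have hns : Even (s.card + 1) := by rw [Nat.even_add_one]; exact hs
      rw [if_neg hs, if_pos hns]

variable (T : Finset ℕ) {t : ℕ} (e : Fin t ≃ ↥T)

/-- The product along an enumeration `e : Fin t ≃ T` is `∏ T`. [cite: RedeiReichardt1934] -/
theorem prod_enum_eq : ∏ i, ((e i : ↥T) : ℕ) = ∏ q ∈ T, q := by
  rw [Fintype.prod_equiv e (fun i => ((e i : ↥T) : ℕ)) (fun x => (x : ℕ)) (fun _ => rfl)]
  exact Finset.prod_coe_sort T (fun q => q)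

/-- Off the diagonal, Li–Ma's entry `[(D_j/p_i) = −1] = [(−q_j/q_i) = −1]` is LINE 49's `legendreBit (−q_j) q_i` (all primes
`≡ 3 (mod 4)`, so `D_j = q_j* = −q_j`). [cite: LiMa2008, Thm. 0.4] [cite: RedeiReichardt1934] -/
theorem redeiMatrix_enum_apply_of_ne (hT : ∀ q ∈ T, q.Prime ∧ q % 4 = 3) (n : ℕ) {i j : Fin t} (hij : i ≠ j) :
    redeiMatrix n (fun k => ((e k : ↥T) : ℕ)) i j = redeiLaplacian T (e i) (e j) := by
  obtain ⟨hpi, hi3⟩ := hT _ (e i).2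
  obtain ⟨hpj, hj3⟩ := hT _ (e j).2
  have hne : (e j) ≠ (e i) := fun h => hij (e.injective h).symm
  have hinj : Function.Injective (fun k => ((e k : ↥T) : ℕ)) := fun _ _ h => e.injective (Subtype.ext h)
  rw [redeiMatrix_apply_of_ne n _ hij, redeiLaplacian_apply_of_ne T hne,
    primeDisc_of_ne_two n (show ((e j : ↥T) : ℕ) ≠ 2 by omega), if_neg (show ¬ ((e j : ↥T) : ℕ) % 4 = 1 by omega)]
  have ha : (((-(((e j : ↥T) : ℕ) : ℤ)) : ℤ) : ZMod ((e i : ↥T) : ℕ)) ≠ 0 := by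
    rw [Int.cast_neg, neg_ne_zero, Int.cast_natCast]
    exact natCast_zmod_ne_zero_of_prime_ne hpi hpj (fun h => hij (hinj h).symm)
  rw [kroneckerBit_eq_ite hpi (by omega) ha]
  rfl

/-- **`RM(−n)` along the enumeration `e` is `Ĝ(T)` reindexed** (`n` arbitrary in the first slot: for odd primes the entries of
`redeiMatrix n p` do not depend on `n`). [cite: LiMa2008, Thm. 0.4] [cite: RedeiReichardt1934] -/
theorem redeiMatrix_enum_eq_submatrix (hT : ∀ q ∈ T, q.Prime ∧ q % 4 = 3) (n : ℕ) :
    redeiMatrix n (fun k => ((e k : ↥T) : ℕ)) = (redeiLaplacian T).submatrix e e := by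
  ext i j
  rw [submatrix_apply]
  by_cases hij : i = j
  · subst hij
    rw [redeiMatrix_apply_self, redeiLaplacian_apply_self]
    have himg : univ.erase (e i) = (univ.erase i).image e := by
      ext x
      simp only [mem_erase, mem_image, mem_univ, and_true, ne_eq]
      constructor
      · intro hx
        exact ⟨e.symm x, fun h => hx (by rw [← h, Equiv.apply_symm_apply]), Equiv.apply_symm_apply _ _⟩
      · rintro ⟨a, ha, rfl⟩
        exact fun h => ha (e.injective h)
    rw [himg, sum_image (fun _ _ _ _ h => e.injective h)]
    exact sum_congr rfl fun j hj => redeiMatrix_enum_apply_of_ne T e hT n (ne_of_mem_erase hj).symm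
  · exact redeiMatrix_enum_apply_of_ne T e hT n hij

/-- The kernels of `RM` (along `e`) and `Ĝ(T)` have the same size (reindexing). [cite: LiMa2008, Thm. 0.4] -/
theorem card_ker_redeiMatrix_enum_eq (hT : ∀ q ∈ T, q.Prime ∧ q % 4 = 3) (n : ℕ) :
    Fintype.card {v : Fin t → ZMod 2 // redeiMatrix n (fun k => ((e k : ↥T) : ℕ)) *ᵥ v = 0} =
      Fintype.card {w : ↥T → ZMod 2 // redeiLaplacian T *ᵥ w = 0} := by
  rw [redeiMatrix_enum_eq_submatrix T e hT n]
  refine Fintype.card_congr (Equiv.subtypeEquiv (e.arrowCongr (Equiv.refl (ZMod 2))) fun v => ?_)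
  rw [submatrix_mulVec_equiv]
  change (redeiLaplacian T *ᵥ (v ∘ e.symm)) ∘ e = 0 ↔ redeiLaplacian T *ᵥ (v ∘ e.symm) = 0
  constructor
  · intro h
    funext x
    have hx := congr_fun h (e.symm x)
    simp only [Function.comp_apply, Equiv.apply_symm_apply, Pi.zero_apply] at hx
    exact hx
  · intro h
    rw [h]
    rfl

variable (Q₀ : Finset ℕ) (p₀ : ℕ)

/-- **Cor 10.3 (d), UNCONDITIONAL: `det B(Q₀, p₀) = 1 ⟺ #(Cl² ∩ Cl[2])(ℚ(√−p₀M₀)) = 1`** (`⟺ r₄ = 0 ⟺` the genus class number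
`2^{−k} h(−p₀M₀)` is odd), `M₀ = ∏ Q₀`, on every cell of LINE 49 (all primes `≡ 3 (mod 4)`, `#Q₀` even) — through the tree's
PROOF of the Rédei–Reichardt theorem (`redeiReichardt_fourTwoCard_classGroup_holds`).  (Brick §7 (d) ∘ §8.)
[cite: LiMa2008, Thm. 0.4] [cite: Tian2014, Thm. 1.1] -/
theorem det_borderedLaplacian_eq_one_iff_fourTwoCard_eq_one
    (h₀ : p₀ ∉ Q₀) (hT : ∀ q ∈ insert p₀ Q₀, q.Prime ∧ q % 4 = 3) (hev : Even Q₀.card)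
    (K : Type) [Field K] [NumberField K]
    (hK : IsQuadraticFieldOfSqrt K (-((p₀ * ∏ q ∈ Q₀, q : ℕ) : ℤ))) :
    (borderedLaplacian Q₀ p₀).det = 1 ↔ fourTwoCard (ClassGroup (𝓞 K)) = 1 := by
  set T := insert p₀ Q₀ with hTdef
  let e : Fin T.card ≃ ↥T := (Fintype.equivFinOfCardEq (Fintype.card_coe T)).symm
  have hodd : Odd T.card := by
    rw [hTdef, card_insert_of_notMem h₀]; exact hev.add_one
  have hn : (p₀ * ∏ q ∈ Q₀, q) = ∏ q ∈ T, q := by rw [hTdef, prod_insert h₀]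
  have hn3 : (∏ q ∈ T, q) % 4 = 3 := by
    rw [prod_mod_four_eq T fun q hq => (hT q hq).2, if_neg (Nat.not_even_iff_odd.mpr hodd)]
  have hprod' : ∏ i, ((e i : ↥T) : ℕ) = if (∏ q ∈ T, q) % 4 = 1 then 2 * ∏ q ∈ T, q else ∏ q ∈ T, q := by
    rw [if_neg (by omega), prod_enum_eq]
  have hinj : Function.Injective (fun k => ((e k : ↥T) : ℕ)) := fun _ _ h => e.injective (Subtype.ext h)
  rw [det_borderedLaplacian_eq_one_iff Q₀ p₀ h₀ hT hev, ← card_ker_redeiMatrix_enum_eq T e hT (∏ q ∈ T, q)]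
  rw [hn] at hK
  rw [card_ker_redeiMatrix_eq_two_mul_fourTwoCard redeiReichardt_fourTwoCard_classGroup_holds
    (fun i => (hT _ (e i).2).1) hinj hprod' K hK]
  omega

/-- **Cor 10.3 (e), UNCONDITIONAL — the door for LINE 49**: on a cell, `det B(Q₀, p₀) = 1` implies that `ℚ(√−p₀M₀)` has no
ideal class of order `4` (Tian's non-degeneracy condition, through the tree's Rédei–Reichardt proof).  (Brick §7 (e) ∘ §8.)
[cite: LiMa2008, Thm. 0.4] [cite: Tian2014, Thm. 1.1] -/
theorem noIdealClassOfOrderFour_of_det_borderedLaplacian_eq_one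
    (h₀ : p₀ ∉ Q₀) (hT : ∀ q ∈ insert p₀ Q₀, q.Prime ∧ q % 4 = 3) (hev : Even Q₀.card)
    (hdet : (borderedLaplacian Q₀ p₀).det = 1) :
    NoIdealClassOfOrderFour (-((p₀ * ∏ q ∈ Q₀, q : ℕ) : ℤ)) := by
  set T := insert p₀ Q₀ with hTdef
  let e : Fin T.card ≃ ↥T := (Fintype.equivFinOfCardEq (Fintype.card_coe T)).symm
  have hodd : Odd T.card := by
    rw [hTdef, card_insert_of_notMem h₀]; exact hev.add_one
  have hn : (p₀ * ∏ q ∈ Q₀, q) = ∏ q ∈ T, q := by rw [hTdef, prod_insert h₀]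
  have hn3 : (∏ q ∈ T, q) % 4 = 3 := by
    rw [prod_mod_four_eq T fun q hq => (hT q hq).2, if_neg (Nat.not_even_iff_odd.mpr hodd)]
  have hprod' : ∏ i, ((e i : ↥T) : ℕ) = if (∏ q ∈ T, q) % 4 = 1 then 2 * ∏ q ∈ T, q else ∏ q ∈ T, q := by
    rw [if_neg (by omega), prod_enum_eq]
  have hinj : Function.Injective (fun k => ((e k : ↥T) : ℕ)) := fun _ _ h => e.injective (Subtype.ext h)
  rw [hn]
  refine noIdealClassOfOrderFour_of_card_ker redeiReichardt_fourTwoCard_classGroup_holds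
    (fun i => (hT _ (e i).2).1) hinj hprod' ?_
  rw [card_ker_redeiMatrix_enum_eq T e hT]
  exact (det_borderedLaplacian_eq_one_iff Q₀ p₀ h₀ hT hev).mp hdet

end ClassGroup

end Summit.BirchSwinnertonDyer.BirchSwinnertonDyer.Theorems.GenusKolyvaginAtTwo.FullVertex.RedeiAdjugate
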